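import Summits.Ventures.LatticeQCDFlow.Scaling.BooleanStarCoupling

/-!
HONEST FRAMING: exact (Metropolis-corrected) sampling algorithms for lattice gauge theory; figures
of merit are autocorrelation/cost numbers at stated couplings and volumes; no continuum-physics
claim.

# BooleanStarDisagreementPotential — THE DISAGREEMENT POTENTIAL `Φ(x,y) = θ·𝟙{x_0 ≠ y_0} + #{cold levels where x ≠ y}` OF THE
# BOOLEAN STAR: LOCALITY, AND THE SIXTEEN-CASE TABLE OF ONE COUPLED ENTRY — IF THE HUBS AGREE AN ENTRY LOWERS `E Φ` BY
# `(1−θ)·a·𝟙{x_l ≠ y_l}`, IF THEY DIFFER IT RAISES IT BY AT MOST `(1−θ)·𝟙{x_l = y_l}` (lean-2 GEN-30, ours)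

Venture-side (OURS).  Cell `lqcd-flow` (pub-lqcd), unit `pub-lqcd-lean-2-g30`, 2026-08-28.  Chapter P (OPEN-MATH-chapterM item 1 on
the two-point family), file 2.  Setting of `Scaling/BooleanStarCoupling` (two-point replicas, identity maps on the hub list `κ`, acceptances `α_r`
as a hypothesis-equation).  The potential is carried as the hypothesis-equation `Φ(x,y) = Σ_k c_k·𝟙{x_k ≠ y_k}` with `c_0 = θ`, `c_k = 1`
(`k ≥ 1`): a disagreement parked at the hub — where the next redraw kills it — is worth `θ ≤ 1`, a cold disagreement is worth `1`.

## What is proved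

* §4 `boolSwap_apply` (the identity-map swap exchanges levels `0` and `l = κ_r+1`), **`potential_local_pair`** ∕ **`potential_local_single`**
  (`Φ` changes only through the touched levels), `potential_nonneg`, `potential_eq_hub_add_cold`, `potential_le` (`Φ ≤ θ + K`),
  **`potential_ge_of_ne`** (`x ≠ y ⇒ Φ(x,y) ≥ θ`, `θ ≤ 1`).
* §5 **`swapBracket_le`** — THE TABLE, pure arithmetic on the four touched bits `(x_0, x_l, y_0, y_l)`: with joint-move weight
  `β ≤ α_x, α_y` (`= α_x = α_y` when the copies agree on the entry), acceptances `≤ 1` and `≥ a` between unequal contents, `0 ≤ θ ≤ 1`, the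
  coupled entry's expected potential is `≤ Φ − (1−θ)a·𝟙{x_l ≠ y_l}` (hubs agree) ∕ `≤ Φ + (1−θ)·𝟙{x_l = y_l}` (hubs differ) — sixteen cases,
  each linear arithmetic.
* §6 `accept_eq_of_agree` (the acceptance depends on the two touched bits only), **`syncSwap_potential_le`** — the table instantiated on
  the coupled chain: for every pair and entry,
  `min·Φ(y_r x, y_r y) + (α_x − min)·Φ(y_r x, y) + (α_y − min)·Φ(x, y_r y) + (1 − α_x − α_y + min)·Φ(x,y) ≤ Φ(x,y) + bonus_r(x,y)`.

Reading (no numerics implied): under the synchronous coupling disagreements are never created; they travel hub ↔ cold levels and die at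
the hub.  NOT CLAIMED here: the chain-level contraction (file 3).  Literature grade (cell rule): OWN; nothing cited; no new bib keys.
-/

noncomputable section

open Finset Function
open Literature.Probability.MarkovChains

namespace Summit.Ventures.LatticeQCDFlow.Scaling

variable {K m : ℕ} {μ : Fin (K + 1) → Bool → ℝ} {M : Fin (K + 1) → Bool → Bool → ℝ} {w : Fin (K + 1) → ℝ} {t : ℝ}

section Drift
variable (κ : Fin m → Fin K)

/-! ## §4 The disagreement potential and its locality -/

/-- The swap image through the identity map: level `0` receives `x_l`, level `l` receives `x_0`, nothing else moves. [ours] -/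
theorem boolSwap_apply (r : Fin m) (x : Fin (K + 1) → Bool) (k : Fin (K + 1)) :
    edgeFlowSwap (Equiv.refl Bool) 0 (κ r).succ x k
      = if k = 0 then x (κ r).succ else if k = (κ r).succ then x 0 else x k := by
  have hl : (0 : Fin (K + 1)) ≠ (κ r).succ := (Fin.succ_ne_zero (κ r)).symm
  by_cases h0 : k = 0
  · subst h0; rw [if_pos rfl, edgeFlowSwap_fst _ hl]; rfl
  · rw [if_neg h0]
    by_cases hl' : k = (κ r).succ
    · subst hl'; rw [if_pos rfl, edgeFlowSwap_snd]; rfl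
    · rw [if_neg hl', edgeFlowSwap_of_ne _ _ _ _ h0 hl']

/-- **Locality of the potential `Φ(x,y) = Σ_k c_k·𝟙{x_k ≠ y_k}` (`c_0 = θ`, `c_k = 1` else):** if `(x',y')` agrees with `(x,y)` off the
two levels `0` and `l = κ_r+1`, then `Φ(x',y') = Φ(x,y) + θ·(𝟙{x'_0 ≠ y'_0} − 𝟙{x_0 ≠ y_0}) + (𝟙{x'_l ≠ y'_l} − 𝟙{x_l ≠ y_l})`. [ours] -/
theorem potential_local_pair {θ : ℝ} {Φ : (Fin (K + 1) → Bool) × (Fin (K + 1) → Bool) → ℝ}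
    (hΦ : ∀ a, Φ a = ∑ k : Fin (K + 1), (if k = 0 then θ else 1) * (if a.1 k = a.2 k then (0 : ℝ) else 1))
    (r : Fin m) {x y x' y' : Fin (K + 1) → Bool}
    (hoff : ∀ k : Fin (K + 1), k ≠ 0 → k ≠ (κ r).succ → x' k = x k ∧ y' k = y k) :
    Φ (x', y') = Φ (x, y) + θ * ((if x' 0 = y' 0 then (0 : ℝ) else 1) - (if x 0 = y 0 then (0 : ℝ) else 1))
      + ((if x' (κ r).succ = y' (κ r).succ then (0 : ℝ) else 1) - (if x (κ r).succ = y (κ r).succ then (0 : ℝ) else 1)) := by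
  have hl : (0 : Fin (K + 1)) ≠ (κ r).succ := (Fin.succ_ne_zero (κ r)).symm
  rw [hΦ, hΦ]
  dsimp only
  have hdiff : ∑ k : Fin (K + 1), (if k = 0 then θ else 1) * (if x' k = y' k then (0 : ℝ) else 1)
      - ∑ k : Fin (K + 1), (if k = 0 then θ else 1) * (if x k = y k then (0 : ℝ) else 1)
      = ∑ k : Fin (K + 1),
          (if k = 0 then θ else 1) * ((if x' k = y' k then (0 : ℝ) else 1) - (if x k = y k then (0 : ℝ) else 1)) := by
    rw [← Finset.sum_sub_distrib]
    exact sum_congr rfl fun k _ => by ring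
  have hsub : ∑ k : Fin (K + 1),
          (if k = 0 then θ else 1) * ((if x' k = y' k then (0 : ℝ) else 1) - (if x k = y k then (0 : ℝ) else 1))
      = ∑ k ∈ ({0, (κ r).succ} : Finset (Fin (K + 1))),
          (if k = 0 then θ else 1) * ((if x' k = y' k then (0 : ℝ) else 1) - (if x k = y k then (0 : ℝ) else 1)) := by
    symm
    refine Finset.sum_subset (Finset.subset_univ _) fun k _ hk => ?_
    rw [Finset.mem_insert, Finset.mem_singleton, not_or] at hk
    obtain ⟨h1, h2⟩ := hoff k hk.1 hk.2
    rw [h1, h2]; ring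
  have hpair : ∑ k ∈ ({0, (κ r).succ} : Finset (Fin (K + 1))),
      (if k = 0 then θ else 1) * ((if x' k = y' k then (0 : ℝ) else 1) - (if x k = y k then (0 : ℝ) else 1))
      = θ * ((if x' 0 = y' 0 then (0 : ℝ) else 1) - (if x 0 = y 0 then (0 : ℝ) else 1))
        + 1 * ((if x' (κ r).succ = y' (κ r).succ then (0 : ℝ) else 1)
          - (if x (κ r).succ = y (κ r).succ then (0 : ℝ) else 1)) := by
    rw [Finset.sum_pair hl, if_pos rfl, if_neg hl.symm]
  linarith [hdiff, hsub, hpair]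

/-- **Locality at one level:** if `(x',y')` agrees with `(x,y)` off level `k`, then
`Φ(x',y') = Φ(x,y) + c_k·(𝟙{x'_k ≠ y'_k} − 𝟙{x_k ≠ y_k})`. [ours] -/
theorem potential_local_single {θ : ℝ} {Φ : (Fin (K + 1) → Bool) × (Fin (K + 1) → Bool) → ℝ}
    (hΦ : ∀ a, Φ a = ∑ k : Fin (K + 1), (if k = 0 then θ else 1) * (if a.1 k = a.2 k then (0 : ℝ) else 1))
    (k : Fin (K + 1)) {x y x' y' : Fin (K + 1) → Bool} (hoff : ∀ j : Fin (K + 1), j ≠ k → x' j = x j ∧ y' j = y j) :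
    Φ (x', y') = Φ (x, y)
      + (if k = 0 then θ else 1) * ((if x' k = y' k then (0 : ℝ) else 1) - (if x k = y k then (0 : ℝ) else 1)) := by
  rw [hΦ, hΦ]
  dsimp only
  have hdiff : ∑ j : Fin (K + 1), (if j = 0 then θ else 1) * (if x' j = y' j then (0 : ℝ) else 1)
      - ∑ j : Fin (K + 1), (if j = 0 then θ else 1) * (if x j = y j then (0 : ℝ) else 1)
      = ∑ j : Fin (K + 1),
          (if j = 0 then θ else 1) * ((if x' j = y' j then (0 : ℝ) else 1) - (if x j = y j then (0 : ℝ) else 1)) := by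
    rw [← Finset.sum_sub_distrib]
    exact sum_congr rfl fun j _ => by ring
  have hsub : ∑ j : Fin (K + 1),
          (if j = 0 then θ else 1) * ((if x' j = y' j then (0 : ℝ) else 1) - (if x j = y j then (0 : ℝ) else 1))
      = ∑ j ∈ ({k} : Finset (Fin (K + 1))),
          (if j = 0 then θ else 1) * ((if x' j = y' j then (0 : ℝ) else 1) - (if x j = y j then (0 : ℝ) else 1)) := by
    symm
    refine Finset.sum_subset (Finset.subset_univ _) fun j _ hj => ?_
    rw [Finset.mem_singleton] at hj
    obtain ⟨h1, h2⟩ := hoff j hj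
    rw [h1, h2]; ring
  rw [Finset.sum_singleton] at hsub
  linarith [hdiff, hsub]

/-- The potential is non-negative (`θ ≥ 0`). [ours] -/
theorem potential_nonneg {θ : ℝ} (hθ0 : 0 ≤ θ) {Φ : (Fin (K + 1) → Bool) × (Fin (K + 1) → Bool) → ℝ}
    (hΦ : ∀ a, Φ a = ∑ k : Fin (K + 1), (if k = 0 then θ else 1) * (if a.1 k = a.2 k then (0 : ℝ) else 1))
    (a : (Fin (K + 1) → Bool) × (Fin (K + 1) → Bool)) : 0 ≤ Φ a := by
  rw [hΦ]
  exact sum_nonneg fun k _ => mul_nonneg (by split_ifs <;> linarith) (by split_ifs <;> norm_num)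

/-- The potential in hub/cold form: `Φ(x,y) = θ·𝟙{x_0 ≠ y_0} + #{cold levels where x and y differ}`. [ours] -/
theorem potential_eq_hub_add_cold {θ : ℝ} {Φ : (Fin (K + 1) → Bool) × (Fin (K + 1) → Bool) → ℝ}
    (hΦ : ∀ a, Φ a = ∑ k : Fin (K + 1), (if k = 0 then θ else 1) * (if a.1 k = a.2 k then (0 : ℝ) else 1))
    (x y : Fin (K + 1) → Bool) :
    Φ (x, y) = θ * (if x 0 = y 0 then (0 : ℝ) else 1) + ∑ j : Fin K, (if x j.succ = y j.succ then (0 : ℝ) else 1) := by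
  rw [hΦ, Fin.sum_univ_succ]
  dsimp only
  rw [if_pos rfl]
  congr 1
  exact sum_congr rfl fun j _ => by rw [if_neg (Fin.succ_ne_zero j), one_mul]

/-- `Φ ≤ θ + K`. [ours] -/
theorem potential_le {θ : ℝ} (hθ0 : 0 ≤ θ) {Φ : (Fin (K + 1) → Bool) × (Fin (K + 1) → Bool) → ℝ}
    (hΦ : ∀ a, Φ a = ∑ k : Fin (K + 1), (if k = 0 then θ else 1) * (if a.1 k = a.2 k then (0 : ℝ) else 1))
    (x y : Fin (K + 1) → Bool) : Φ (x, y) ≤ θ + K := by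
  rw [potential_eq_hub_add_cold hΦ]
  have h1 : θ * (if x 0 = y 0 then (0 : ℝ) else 1) ≤ θ := by
    split_ifs
    · rw [mul_zero]; exact hθ0
    · rw [mul_one]
  have h2 : ∑ j : Fin K, (if x j.succ = y j.succ then (0 : ℝ) else 1) ≤ K :=
    calc ∑ j : Fin K, (if x j.succ = y j.succ then (0 : ℝ) else 1) ≤ ∑ _j : Fin K, (1 : ℝ) :=
          sum_le_sum fun j _ => by split_ifs <;> norm_num
      _ = K := by rw [sum_const, card_univ, Fintype.card_fin, nsmul_eq_mul, mul_one]
  linarith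

/-- **Two different configurations are at potential distance at least `θ`** (`0 ≤ θ ≤ 1`). [ours] -/
theorem potential_ge_of_ne {θ : ℝ} (hθ0 : 0 ≤ θ) (hθ1 : θ ≤ 1) {Φ : (Fin (K + 1) → Bool) × (Fin (K + 1) → Bool) → ℝ}
    (hΦ : ∀ a, Φ a = ∑ k : Fin (K + 1), (if k = 0 then θ else 1) * (if a.1 k = a.2 k then (0 : ℝ) else 1))
    {x y : Fin (K + 1) → Bool} (hxy : x ≠ y) : θ ≤ Φ (x, y) := by
  obtain ⟨k, hk⟩ := Function.ne_iff.mp hxy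
  rw [hΦ]
  calc θ ≤ (if k = 0 then θ else 1) * (if (x, y).1 k = (x, y).2 k then (0 : ℝ) else 1) := by
        dsimp only; rw [if_neg hk, mul_one]; split_ifs; exacts [le_rfl, hθ1]
    _ ≤ ∑ k : Fin (K + 1), (if k = 0 then θ else 1) * (if (x, y).1 k = (x, y).2 k then (0 : ℝ) else 1) :=
        Finset.single_le_sum (f := fun k : Fin (K + 1) =>
            (if k = 0 then θ else 1) * (if (x, y).1 k = (x, y).2 k then (0 : ℝ) else 1))
          (fun j _ => mul_nonneg (by split_ifs <;> linarith) (by split_ifs <;> norm_num)) (mem_univ k)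

/-! ## §5 The sixteen-case table of one entry -/

/-- **THE ENTRY TABLE (pure arithmetic on the four touched bits `u = x_0`, `v = x_l`, `u' = y_0`, `v' = y_l`):** with joint-move weight
`β ≤ α_x, α_y` (equal to both when the copies agree on the entry), acceptances `≤ 1` and `≥ a` between unequal contents, and
`0 ≤ θ ≤ 1`, the expected potential after the coupled entry move is at most `Φ − (1−θ)·a·𝟙{x_l ≠ y_l}` if the hubs agree and at most
`Φ + (1−θ)·𝟙{x_l = y_l}` if they differ. [ours] -/
theorem swapBracket_le (u v u' v' : Bool) {θ a αx αy β Φ0 : ℝ} (hθ0 : 0 ≤ θ) (hθ1 : θ ≤ 1)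
    (h1x : αx ≤ 1) (h1y : αy ≤ 1) (hβx : β ≤ αx) (hβy : β ≤ αy)
    (hax : a * (if u = v then (0 : ℝ) else 1) ≤ αx * (if u = v then (0 : ℝ) else 1))
    (hay : a * (if u' = v' then (0 : ℝ) else 1) ≤ αy * (if u' = v' then (0 : ℝ) else 1))
    (hβ : (αx - β) * (if u = u' then (1 : ℝ) else 0) * (if v = v' then (1 : ℝ) else 0) = 0
      ∧ (αy - β) * (if u = u' then (1 : ℝ) else 0) * (if v = v' then (1 : ℝ) else 0) = 0) :
    β * (Φ0 + θ * (if v = v' then 0 else 1) + (if u = u' then 0 else 1))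
      + (αx - β) * (Φ0 + θ * (if v = u' then 0 else 1) + (if u = v' then 0 else 1))
      + (αy - β) * (Φ0 + θ * (if u = v' then 0 else 1) + (if v = u' then 0 else 1))
      + (1 - αx - αy + β) * (Φ0 + θ * (if u = u' then 0 else 1) + (if v = v' then 0 else 1))
    ≤ Φ0 + θ * (if u = u' then 0 else 1) + (if v = v' then (0 : ℝ) else 1)
      + (if u = u' then -((1 - θ) * a * (if v = v' then (0 : ℝ) else 1)) else (1 - θ) * (if v = v' then (1 : ℝ) else 0)) := by
  have hxβ : 0 ≤ αx - β := sub_nonneg.mpr hβx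
  have hyβ : 0 ≤ αy - β := sub_nonneg.mpr hβy
  have hθ' : 0 ≤ 1 - θ := sub_nonneg.mpr hθ1
  have hax' := mul_le_mul_of_nonneg_left hax hθ'
  have hay' := mul_le_mul_of_nonneg_left hay hθ'
  obtain ⟨hβ1, hβ2⟩ := hβ
  cases u <;> cases v <;> cases u' <;> cases v' <;>
    simp only [Bool.true_eq_false, Bool.false_eq_true, if_true, if_false] at hax hay hax' hay' hβ1 hβ2 ⊢ <;>
    nlinarith [mul_nonneg hθ' (sub_nonneg.mpr h1y), mul_nonneg hθ' (sub_nonneg.mpr h1x), mul_nonneg hθ' hxβ,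
      mul_nonneg hθ' hyβ, mul_nonneg hθ0 hxβ, mul_nonneg hθ0 hyβ, hax, hay, hax', hay', hβ1, hβ2]

/-! ## §6 The entry bound for the coupled chain -/

/-- The acceptance of an entry depends on the configuration only through the two touched bits: copies that agree at `0` and at
`l = κ_r+1` have the same acceptance (`μ > 0`). [ours] -/
theorem accept_eq_of_agree (hμ : ∀ k x, 0 < μ k x) {α : Fin m → (Fin (K + 1) → Bool) → ℝ}
    (hα : ∀ r z, α r z = min 1 (tensorFun μ (edgeFlowSwap (Equiv.refl Bool) 0 (κ r).succ z) / tensorFun μ z))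
    (r : Fin m) {x y : Fin (K + 1) → Bool} (h0 : x 0 = y 0) (hl : x (κ r).succ = y (κ r).succ) : α r x = α r y := by
  have hx := accept_mul_pair κ (fun _ : Fin m => Equiv.refl Bool) hμ hα r x
  have hy := accept_mul_pair κ (fun _ : Fin m => Equiv.refl Bool) hμ hα r y
  simp only [Equiv.refl_symm, Equiv.refl_apply] at hx hy
  rw [h0, hl] at hx
  have hpos : 0 < μ 0 (y 0) * μ (κ r).succ (y (κ r).succ) := mul_pos (hμ _ _) (hμ _ _)
  exact mul_right_cancel₀ hpos.ne' (hx.trans hy.symm)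

/-- **THE ENTRY BOUND:** for every pair `(x,y)` and entry `r` (`l = κ_r+1`), with `a ≤ α_r(z)` whenever `z_0 ≠ z_l` (`0 ≤ θ ≤ 1`, `μ > 0`),
`min{α_x,α_y}·Φ(y_r x, y_r y) + (α_x − min)·Φ(y_r x, y) + (α_y − min)·Φ(x, y_r y) + (1 − α_x − α_y + min)·Φ(x,y)`
`≤ Φ(x,y) − (1−θ)·a·𝟙{x_l ≠ y_l}` if `x_0 = y_0`, and `≤ Φ(x,y) + (1−θ)·𝟙{x_l = y_l}` if `x_0 ≠ y_0`. [ours] -/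
theorem syncSwap_potential_le (hμ : ∀ k x, 0 < μ k x) {θ a : ℝ} (hθ0 : 0 ≤ θ) (hθ1 : θ ≤ 1)
    {α : Fin m → (Fin (K + 1) → Bool) → ℝ}
    (hα : ∀ r z, α r z = min 1 (tensorFun μ (edgeFlowSwap (Equiv.refl Bool) 0 (κ r).succ z) / tensorFun μ z))
    (ha : ∀ r z, z 0 ≠ z (κ r).succ → a ≤ α r z)
    {Φ : (Fin (K + 1) → Bool) × (Fin (K + 1) → Bool) → ℝ}
    (hΦ : ∀ a, Φ a = ∑ k : Fin (K + 1), (if k = 0 then θ else 1) * (if a.1 k = a.2 k then (0 : ℝ) else 1))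
    (r : Fin m) (x y : Fin (K + 1) → Bool) :
    min (α r x) (α r y) * Φ (edgeFlowSwap (Equiv.refl Bool) 0 (κ r).succ x, edgeFlowSwap (Equiv.refl Bool) 0 (κ r).succ y)
      + (α r x - min (α r x) (α r y)) * Φ (edgeFlowSwap (Equiv.refl Bool) 0 (κ r).succ x, y)
      + (α r y - min (α r x) (α r y)) * Φ (x, edgeFlowSwap (Equiv.refl Bool) 0 (κ r).succ y)
      + (1 - α r x - α r y + min (α r x) (α r y)) * Φ (x, y)
    ≤ Φ (x, y) + (if x 0 = y 0 then -((1 - θ) * a * (if x (κ r).succ = y (κ r).succ then (0 : ℝ) else 1))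
        else (1 - θ) * (if x (κ r).succ = y (κ r).succ then (1 : ℝ) else 0)) := by
  have hl : (0 : Fin (K + 1)) ≠ (κ r).succ := (Fin.succ_ne_zero (κ r)).symm
  have hacc := accept_mem κ (fun _ : Fin m => Equiv.refl Bool) hμ hα r
  set yx := edgeFlowSwap (Equiv.refl Bool) 0 (κ r).succ x with hyx
  set yy := edgeFlowSwap (Equiv.refl Bool) 0 (κ r).succ y with hyy
  -- the touched bits of the images
  have hyx0 : yx 0 = x (κ r).succ := by rw [hyx, boolSwap_apply, if_pos rfl]
  have hyxl : yx (κ r).succ = x 0 := by rw [hyx, boolSwap_apply, if_neg hl.symm, if_pos rfl]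
  have hyy0 : yy 0 = y (κ r).succ := by rw [hyy, boolSwap_apply, if_pos rfl]
  have hyyl : yy (κ r).succ = y 0 := by rw [hyy, boolSwap_apply, if_neg hl.symm, if_pos rfl]
  have hyxk : ∀ k : Fin (K + 1), k ≠ 0 → k ≠ (κ r).succ → yx k = x k := fun k h1 h2 => by
    rw [hyx, boolSwap_apply, if_neg h1, if_neg h2]
  have hyyk : ∀ k : Fin (K + 1), k ≠ 0 → k ≠ (κ r).succ → yy k = y k := fun k h1 h2 => by
    rw [hyy, boolSwap_apply, if_neg h1, if_neg h2]
  -- the untouched part of the potential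
  set Φ0 := Φ (x, y) - θ * (if x 0 = y 0 then (0 : ℝ) else 1) - (if x (κ r).succ = y (κ r).succ then (0 : ℝ) else 1)
    with hΦ0
  have e1 : Φ (yx, yy) = Φ0 + θ * (if x (κ r).succ = y (κ r).succ then (0 : ℝ) else 1) + (if x 0 = y 0 then (0 : ℝ) else 1) := by
    have h := potential_local_pair κ hΦ r (x := x) (y := y) (x' := yx) (y' := yy) fun k h1 h2 => ⟨hyxk k h1 h2, hyyk k h1 h2⟩
    rw [hyx0, hyxl, hyy0, hyyl] at h; rw [h, hΦ0]; ring
  have e2 : Φ (yx, y) = Φ0 + θ * (if x (κ r).succ = y 0 then (0 : ℝ) else 1) + (if x 0 = y (κ r).succ then (0 : ℝ) else 1) := by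
    have h := potential_local_pair κ hΦ r (x := x) (y := y) (x' := yx) (y' := y) fun k h1 h2 => ⟨hyxk k h1 h2, rfl⟩
    rw [hyx0, hyxl] at h; rw [h, hΦ0]; ring
  have e3 : Φ (x, yy) = Φ0 + θ * (if x 0 = y (κ r).succ then (0 : ℝ) else 1) + (if x (κ r).succ = y 0 then (0 : ℝ) else 1) := by
    have h := potential_local_pair κ hΦ r (x := x) (y := y) (x' := x) (y' := yy) fun k h1 h2 => ⟨rfl, hyyk k h1 h2⟩
    rw [hyy0, hyyl] at h; rw [h, hΦ0]; ring
  have e4 : Φ (x, y) = Φ0 + θ * (if x 0 = y 0 then (0 : ℝ) else 1) + (if x (κ r).succ = y (κ r).succ then (0 : ℝ) else 1) := by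
    rw [hΦ0]; ring
  -- the hypotheses of the table
  have hax : a * (if x 0 = x (κ r).succ then (0 : ℝ) else 1) ≤ α r x * (if x 0 = x (κ r).succ then (0 : ℝ) else 1) := by
    split_ifs with h
    · rw [mul_zero, mul_zero]
    · rw [mul_one, mul_one]; exact ha r x h
  have hay : a * (if y 0 = y (κ r).succ then (0 : ℝ) else 1) ≤ α r y * (if y 0 = y (κ r).succ then (0 : ℝ) else 1) := by
    split_ifs with h
    · rw [mul_zero, mul_zero]
    · rw [mul_one, mul_one]; exact ha r y h
  have hβ : (α r x - min (α r x) (α r y)) * (if x 0 = y 0 then (1 : ℝ) else 0) * (if x (κ r).succ = y (κ r).succ then (1 : ℝ) else 0) = 0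
      ∧ (α r y - min (α r x) (α r y)) * (if x 0 = y 0 then (1 : ℝ) else 0)
        * (if x (κ r).succ = y (κ r).succ then (1 : ℝ) else 0) = 0 := by
    by_cases h0 : x 0 = y 0
    · by_cases hl' : x (κ r).succ = y (κ r).succ
      · have := accept_eq_of_agree κ hμ hα r h0 hl'
        rw [this, min_self, sub_self, zero_mul, zero_mul]; exact ⟨rfl, rfl⟩
      · rw [if_neg hl', mul_zero, mul_zero]; exact ⟨rfl, rfl⟩
    · rw [if_neg h0, mul_zero, zero_mul, mul_zero, zero_mul]; exact ⟨rfl, rfl⟩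
  rw [e1, e2, e3, e4]
  have key := swapBracket_le (x 0) (x (κ r).succ) (y 0) (y (κ r).succ) (Φ0 := Φ0) hθ0 hθ1 (hacc x).2 (hacc y).2
    (min_le_left (α r x) (α r y)) (min_le_right (α r x) (α r y)) hax hay hβ
  convert key using 2

end Drift

end Summit.Ventures.LatticeQCDFlow.Scaling

end
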